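import Summits.Ventures.YMGap.Census.DecimationInterpolated
import Summits.Ventures.YMGap.Census.ZplusMonotone
import HarnessLib

/-!
# Venture YMGap, track (b) census — the right-hand sides of III.1 (3.4) and IV.3 (4.12) are DECREASING in `r`

HONEST FRAMING: venture file of the cell `pub-ymgap` (QuantumFields programme), track (b) census.  Exact statements about the finite
torus `(ℤ/Lℤ)^d` (even `L`); nothing about (5.15), confinement or any limit.

Tomboulis (arXiv:0707.2179, Prop. III.1, second sentence: "The r.h.s. in (U) is a monotonically decreasing function of `r` on
`0 < r ≤ 1`"; Prop. IV.3, second sentence, the same for (Uplus)).  On the positivity domain `ĉ_j ∈ [0,1]`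
(`hatCoeff_nonneg`, `hatCoeff_le_one`), so `c^U_j(1,r) = ĉ_j^{b²r}` is non-increasing in `r ≥ 0` (`mkCoeff_antitone`); by II.1 (i)
(`coeffMonotone`, even `L`) and IV.2 (i) (`torusZplus_mono`, even `L`) the decimated partition functions
`F₀^U(1)^{|Λ^{(1)}|} Z_{(ℤ/L)^d}({c^U_j(1,r)})` and `F₀^U(1)^{|Λ^{(1)}|} Z⁺_{(ℤ/L)^d}({c^U_j(1,r)})` are non-increasing in `r ≥ 0`
(`decimationRhs_antitoneOn`, `decimationRhsPlus_antitoneOn`).  Printed "monotonically decreasing"; the kernel rows are the non-strict form.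
[cite: Tomboulis2007Confinement, Prop. III.1 (second sentence); Prop. IV.3 (second sentence)]
-/

noncomputable section

open MeasureTheory Finset Real
open scoped BigOperators
open Literature.MathematicalPhysics.QuantumLattice
open Literature.MathematicalPhysics.QuantumFieldTheory
open Literature.MathematicalPhysics.QuantumFieldTheory.Tomboulis2007

namespace Summit.Ventures.YMGap.Census

variable {d L b : ℕ} [NeZero L]

omit [NeZero L] in
/-- **`c^U_j(1,r') ≤ c^U_j(1,r)` for `0 ≤ r ≤ r'`** on the positivity domain (`ĉ_j ∈ [0,1]`). -/
theorem mkCoeff_antitone (J : ℕ) {c : ℕ → ℝ} (hc : ∀ n, 1 ≤ n → 0 ≤ c n) (hf : ∀ g : SU2, 0 ≤ plaqFn J c g) (ζ : ℕ)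
    {r r' : ℝ} (hr0 : 0 ≤ r) (hrr' : r ≤ r') (n : ℕ) : mkCoeff J c ζ b r' n ≤ mkCoeff J c ζ b r n := by
  rw [mkCoeff_eq_rpow, mkCoeff_eq_rpow]
  exact Real.rpow_le_rpow_of_exponent_ge' (hatCoeff_nonneg hc ζ n) (hatCoeff_le_one hc hf ζ n) (by positivity)
    (mul_le_mul_of_nonneg_left hrr' (by positivity))

/-- **III.1, second sentence (arXiv:0707.2179): the right-hand side of (3.4) is non-increasing in `r ≥ 0`** on an even coarse torus,
on the positivity domain: `r ↦ F₀^U(1)^{|Λ^{(1)}|} · Z_{(ℤ/L)^d}({c^U_j(1,r)})` is antitone on `[0, ∞)`. -/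
theorem decimationRhs_antitoneOn [NeZero d] (hL : Even L) (J : ℕ) {c : ℕ → ℝ} (hc : ∀ n, 1 ≤ n → 0 ≤ c n)
    (hf : ∀ g : SU2, 0 ≤ plaqFn J c g) (ζ : ℕ) :
    AntitoneOn (fun r : ℝ => mkF0 J c ζ b ^ Fintype.card (Plaquette d L) * torusZ d L (ζ * J) (mkCoeff J c ζ b r)) (Set.Ici 0) := by
  haveI : Fact (1 < L) := ⟨by obtain ⟨k, hk⟩ := hL; have := NeZero.ne L; omega⟩
  intro r hr r' hr' hrr'
  have hr0 : 0 ≤ r := hr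
  have hr'0 : 0 ≤ r' := hr'
  refine mul_le_mul_of_nonneg_left ?_ (pow_nonneg (zero_le_one.trans (one_le_mkF0 hc ζ b)) _)
  exact coeffMonotone hL _ _ _ (coeffAdmissible_mkCoeff_of_nonneg J hc hf ζ hr'0) (coeffAdmissible_mkCoeff_of_nonneg J hc hf ζ hr0)
    (mkCoeff_antitone J hc hf ζ hr0 hrr')

/-- **IV.3, second sentence (arXiv:0707.2179): the right-hand side of (4.12) is non-increasing in `r ≥ 0`** on an even coarse torus,
every plane, on the positivity domain: `r ↦ F₀^U(1)^{|Λ^{(1)}|} · Z⁺_{(ℤ/L)^d}({c^U_j(1,r)}; 𝒱_{ij})` is antitone on `[0, ∞)`. -/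
theorem decimationRhsPlus_antitoneOn (hL : Even L) (J : ℕ) {i j : Fin d} (hij : i < j) {c : ℕ → ℝ} (hc : ∀ n, 1 ≤ n → 0 ≤ c n)
    (hf : ∀ g : SU2, 0 ≤ plaqFn J c g) (ζ : ℕ) :
    AntitoneOn (fun r : ℝ => mkF0 J c ζ b ^ Fintype.card (Plaquette d L) *
      torusZplus d L (ζ * J) (mkCoeff J c ζ b r) (vortexSheet L i j hij)) (Set.Ici 0) := by
  intro r hr r' hr' hrr'
  have hr0 : 0 ≤ r := hr
  have hr'0 : 0 ≤ r' := hr'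
  refine mul_le_mul_of_nonneg_left ?_ (pow_nonneg (zero_le_one.trans (one_le_mkF0 hc ζ b)) _)
  exact torusZplus_mono hL _ hij (coeffAdmissible_mkCoeff_of_nonneg J hc hf ζ hr'0) (coeffAdmissible_mkCoeff_of_nonneg J hc hf ζ hr0)
    (mkCoeff_antitone J hc hf ζ hr0 hrr')

end Summit.Ventures.YMGap.Census

end
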